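import Mathlib
import Summits.MatrixMultiplication.MatrixMultiplication.Theses.MatrixPointInterpolation

/-!
# `MatrixPointInterpolation.WindowedKaplansky` (stmt-MatrixMultiplication-18945) — helper file 1:
# two-letter noncommutative polynomials, degree windows, and the word filtration

Infrastructure, uniform in the point size `k`, for the windowed Kaplansky problem.  A pair
`A : Fin 2 → M_n(ℂ)` *masquerades as `M_k` to degree `2d`* if every linear combination of words of
length `≤ 2d` vanishing on all pairs of `k × k` matrices vanishes at `A` (the hypothesis `hmasq`
below, copied verbatim from the route statement).  We recast this in terms of the monoid algebra
`NCPoly = ℂ[FreeMonoid (Fin 2)]` of noncommutative polynomials in two letters: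

* `eval₂ E : NCPoly →ₐ[ℂ] R`, evaluation at a pair `E : Fin 2 → R`;
* `deg p`, the maximal length of a word in the support of `p`, with the calculus of the bounds
  `deg p ≤ m` (`add/sub/smul/sum/mul/pow/list_prod`);
* `window_eval₂`: the masquerade hypothesis kills every `p` with `deg p ≤ 2d` that is an identity
  of `M_k(ℂ)`;
* `wordSpan A L`, the span `V_L` of the words of length `≤ L` (syntactically the route's set), with
  `exists_poly_of_mem_wordSpan` (every element of `V_L` is `eval₂ A p` with `deg p ≤ L`),
  `mul_mem_wordSpan` (`V_i · V_j ⊆ V_{i+j}`) and the word count `finrank_wordSpan_le`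
  (`dim V_L ≤ 2^(L+1) - 1`, whence `d ≥ log₂ n²` for a generating degree `d`).
-/

namespace Summit.MatrixMultiplication.MatrixMultiplication.Theorems

namespace Masquerade

open MonoidAlgebra

/-- Words in two letters have decidable equality (as lists). [folklore] -/
instance instDecidableEqWord : DecidableEq (FreeMonoid (Fin 2)) := inferInstanceAs (DecidableEq (List (Fin 2)))

/-- Noncommutative polynomials over `ℂ` in two letters: the monoid algebra of the free monoid on
`Fin 2`. [folklore] -/
abbrev NCPoly : Type := MonoidAlgebra ℂ (FreeMonoid (Fin 2))

section eval

variable {R : Type*} [Ring R] [Algebra ℂ R]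

/-- Evaluation of two-letter noncommutative polynomials at a pair `E`, as an algebra map.
[folklore] -/
noncomputable def eval₂ (E : Fin 2 → R) : NCPoly →ₐ[ℂ] R :=
  MonoidAlgebra.lift ℂ R (FreeMonoid (Fin 2)) (FreeMonoid.lift E)

/-- Evaluation of a monomial. [folklore] -/
theorem eval₂_single (E : Fin 2 → R) (w : FreeMonoid (Fin 2)) (c : ℂ) :
    eval₂ E (single w c) = c • ((FreeMonoid.toList w).map E).prod := by
  simp [eval₂, lift_single, FreeMonoid.lift_apply]

/-- Evaluation as a finite sum over the support. [folklore] -/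
theorem eval₂_apply (E : Fin 2 → R) (p : NCPoly) :
    eval₂ E p = ∑ w ∈ p.coeff.support, p.coeff w • ((FreeMonoid.toList w).map E).prod := by
  conv_lhs => rw [← sum_coeff_single p]
  rw [Finsupp.sum, map_sum]
  exact Finset.sum_congr rfl fun w _ => eval₂_single E w _

end eval

/-! ### Degree windows -/

/-- The degree of a two-letter polynomial: the maximal length of a word in its support (`0` for the
zero polynomial). [folklore] -/
def deg (p : NCPoly) : ℕ := p.coeff.support.sup FreeMonoid.length

/-- `deg p ≤ m` iff every word of the support has length `≤ m`. [folklore] -/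
theorem deg_le_iff {p : NCPoly} {m : ℕ} : deg p ≤ m ↔ ∀ w ∈ p.coeff.support, FreeMonoid.length w ≤ m :=
  Finset.sup_le_iff

/-- Words in the support are no longer than the degree bound. [folklore] -/
theorem length_le_of_mem_support {p : NCPoly} {m : ℕ} (hp : deg p ≤ m) {w : FreeMonoid (Fin 2)}
    (hw : w ∈ p.coeff.support) : FreeMonoid.length w ≤ m :=
  deg_le_iff.1 hp w hw

/-- `deg 0 = 0`. [folklore] -/
theorem deg_zero : deg 0 = 0 := by simp [deg]

/-- The degree of a monomial is at most the length of its word. [folklore] -/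
theorem deg_single_le (w : FreeMonoid (Fin 2)) (c : ℂ) : deg (single w c) ≤ FreeMonoid.length w := by
  rw [deg_le_iff]
  intro v hv
  rw [coeff_single] at hv
  have := Finsupp.support_single_subset hv
  rw [Finset.mem_singleton] at this
  rw [this]

/-- `deg 1 = 0`. [folklore] -/
theorem deg_one : deg 1 = 0 := by
  rw [one_def]
  exact Nat.le_zero.1 (by simpa [FreeMonoid.length_one] using deg_single_le (1 : FreeMonoid (Fin 2)) (1 : ℂ))

/-- Degree bound of a sum. [folklore] -/
theorem deg_add_le {p q : NCPoly} {m : ℕ} (hp : deg p ≤ m) (hq : deg q ≤ m) : deg (p + q) ≤ m := by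
  rw [deg_le_iff] at hp hq ⊢
  intro w hw
  rw [coeff_add] at hw
  rcases Finset.mem_union.1 (Finsupp.support_add hw) with h | h
  · exact hp w h
  · exact hq w h

/-- Degree bound of a scalar multiple. [folklore] -/
theorem deg_smul_le {p : NCPoly} {m : ℕ} (c : ℂ) (hp : deg p ≤ m) : deg (c • p) ≤ m := by
  rw [deg_le_iff] at hp ⊢
  intro w hw
  rw [coeff_smul] at hw
  exact hp w (Finsupp.support_smul hw)

/-- Degree bound of a negation. [folklore] -/
theorem deg_neg_le {p : NCPoly} {m : ℕ} (hp : deg p ≤ m) : deg (-p) ≤ m := by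
  have : -p = (-1 : ℂ) • p := by simp
  rw [this]
  exact deg_smul_le _ hp

/-- Degree bound of a difference. [folklore] -/
theorem deg_sub_le {p q : NCPoly} {m : ℕ} (hp : deg p ≤ m) (hq : deg q ≤ m) : deg (p - q) ≤ m := by
  rw [sub_eq_add_neg]
  exact deg_add_le hp (deg_neg_le hq)

/-- Degree bound of an integer multiple. [folklore] -/
theorem deg_zsmul_le {p : NCPoly} {m : ℕ} (c : ℤ) (hp : deg p ≤ m) : deg (c • p) ≤ m := by
  have : (c • p) = (c : ℂ) • p := by simp [Int.cast_smul_eq_zsmul]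
  rw [this]
  exact deg_smul_le _ hp

/-- Degree bound of a sign multiple. [folklore] -/
theorem deg_units_smul_le {p : NCPoly} {m : ℕ} (c : ℤˣ) (hp : deg p ≤ m) : deg (c • p) ≤ m := by
  rw [Units.smul_def]
  exact deg_zsmul_le _ hp

/-- Degree bound of a finite sum. [folklore] -/
theorem deg_sum_le {ι : Type*} {s : Finset ι} {f : ι → NCPoly} {m : ℕ}
    (h : ∀ i ∈ s, deg (f i) ≤ m) : deg (∑ i ∈ s, f i) ≤ m := by
  classical
  induction s using Finset.induction_on with
  | empty => simp [deg_zero]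
  | insert a s ha ih =>
    rw [Finset.sum_insert ha]
    exact deg_add_le (h a (Finset.mem_insert_self a s)) (ih fun i hi => h i (Finset.mem_insert_of_mem hi))

/-- Degree bound of a product: degrees add. [folklore] -/
theorem deg_mul_le {p q : NCPoly} {m m' : ℕ} (hp : deg p ≤ m) (hq : deg q ≤ m') :
    deg (p * q) ≤ m + m' := by
  classical
  rw [deg_le_iff] at hp hq ⊢
  intro w hw
  have := support_coeff_mul_subset p q hw
  rw [Finset.mem_mul] at this
  obtain ⟨u, hu, v, hv, rfl⟩ := this
  rw [FreeMonoid.length_mul]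
  exact Nat.add_le_add (hp u hu) (hq v hv)

/-- Degree bound of a power. [folklore] -/
theorem deg_pow_le {p : NCPoly} {m : ℕ} (hp : deg p ≤ m) : ∀ j : ℕ, deg (p ^ j) ≤ j * m
  | 0 => by simp [deg_one]
  | j + 1 => by
    rw [pow_succ, Nat.succ_mul]
    exact deg_mul_le (deg_pow_le hp j) hp

/-- Degree bound of a list product. [folklore] -/
theorem deg_list_prod_le {ι : Type*} (f : ι → NCPoly) (d : ι → ℕ) :
    ∀ l : List ι, (∀ i ∈ l, deg (f i) ≤ d i) → deg (l.map f).prod ≤ (l.map d).sum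
  | [], _ => by simp [deg_one]
  | a :: l, h => by
    rw [List.map_cons, List.map_cons, List.prod_cons, List.sum_cons]
    exact deg_mul_le (h a (by simp)) (deg_list_prod_le f d l fun i hi => h i (by simp [hi]))

/-! ### The window in polynomial form -/

/-- The masquerade hypothesis of the route (verbatim), as a polynomial statement: a two-letter
polynomial supported on words of length `≤ 2d` that is an identity of `M_k(ℂ)` vanishes at `A`.
[folklore] -/
theorem window_eval₂ {n k d : ℕ} {A : Fin 2 → Matrix (Fin n) (Fin n) ℂ}
    (hmasq : ∀ (T : Finset (List (Fin 2))) (c : List (Fin 2) → ℂ), (∀ w ∈ T, w.length ≤ 2 * d) →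
      (∀ B : Fin 2 → Matrix (Fin k) (Fin k) ℂ, (∑ w ∈ T, c w • (w.map B).prod) = 0) →
      (∑ w ∈ T, c w • (w.map A).prod) = 0)
    (p : NCPoly) (hp : deg p ≤ 2 * d)
    (hvan : ∀ B : Fin 2 → Matrix (Fin k) (Fin k) ℂ, eval₂ B p = 0) :
    eval₂ A p = 0 := by
  classical
  set T : Finset (List (Fin 2)) := p.coeff.support.image FreeMonoid.toList with hT
  set c : List (Fin 2) → ℂ := fun l => p.coeff (FreeMonoid.ofList l) with hc
  have key : ∀ {m : ℕ} (E : Fin 2 → Matrix (Fin m) (Fin m) ℂ),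
      eval₂ E p = ∑ w ∈ T, c w • (w.map E).prod := by
    intro m E
    rw [eval₂_apply, hT, Finset.sum_image fun x _ y _ h => FreeMonoid.toList.injective h]
    rfl
  have hlen : ∀ w ∈ T, w.length ≤ 2 * d := by
    intro w hw
    rw [hT, Finset.mem_image] at hw
    obtain ⟨v, hv, rfl⟩ := hw
    exact length_le_of_mem_support hp hv
  have := hmasq T c hlen fun B => by rw [← key B]; exact hvan B
  rwa [← key A] at this

/-! ### The word filtration `V_L` -/

/-- `V_L`: the span of the values at `A` of the words of length `≤ L` (syntactically the set used
in the route statement). [folklore] -/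
def wordSpan {n : ℕ} (A : Fin 2 → Matrix (Fin n) (Fin n) ℂ) (L : ℕ) :
    Submodule ℂ (Matrix (Fin n) (Fin n) ℂ) :=
  Submodule.span ℂ {M : Matrix (Fin n) (Fin n) ℂ | ∃ w : List (Fin 2), w.length ≤ L ∧ (w.map A).prod = M}

/-- The word filtration is increasing. [folklore] -/
theorem wordSpan_mono {n : ℕ} (A : Fin 2 → Matrix (Fin n) (Fin n) ℂ) {L L' : ℕ} (h : L ≤ L') :
    wordSpan A L ≤ wordSpan A L' :=
  Submodule.span_mono fun _ ⟨w, hw, hM⟩ => ⟨w, hw.trans h, hM⟩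

/-- Words of length `≤ L` lie in `V_L`. [folklore] -/
theorem prod_mem_wordSpan {n : ℕ} (A : Fin 2 → Matrix (Fin n) (Fin n) ℂ) {L : ℕ}
    (w : List (Fin 2)) (hw : w.length ≤ L) : (w.map A).prod ∈ wordSpan A L :=
  Submodule.subset_span ⟨w, hw, rfl⟩

/-- `1 ∈ V_L` (the empty word). [folklore] -/
theorem one_mem_wordSpan {n : ℕ} (A : Fin 2 → Matrix (Fin n) (Fin n) ℂ) (L : ℕ) :
    (1 : Matrix (Fin n) (Fin n) ℂ) ∈ wordSpan A L := by
  simpa using prod_mem_wordSpan A (L := L) [] (by simp)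

/-- The generators lie in `V_L` for `L ≥ 1`. [folklore] -/
theorem gen_mem_wordSpan {n : ℕ} (A : Fin 2 → Matrix (Fin n) (Fin n) ℂ) {L : ℕ} (hL : 1 ≤ L)
    (x : Fin 2) : A x ∈ wordSpan A L := by
  simpa using prod_mem_wordSpan A (L := L) [x] (by simpa using hL)

/-- Values of polynomials of degree `≤ L` lie in `V_L`. [folklore] -/
theorem eval₂_mem_wordSpan {n : ℕ} (A : Fin 2 → Matrix (Fin n) (Fin n) ℂ) {L : ℕ} {p : NCPoly}
    (hp : deg p ≤ L) : eval₂ A p ∈ wordSpan A L := by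
  rw [eval₂_apply]
  refine Submodule.sum_mem _ fun w hw => Submodule.smul_mem _ _ ?_
  exact prod_mem_wordSpan A _ (length_le_of_mem_support hp hw)

/-- Every element of `V_L` is the value of a polynomial supported on words of length `≤ L`.
[folklore] -/
theorem exists_poly_of_mem_wordSpan {n : ℕ} {A : Fin 2 → Matrix (Fin n) (Fin n) ℂ} {L : ℕ}
    {M : Matrix (Fin n) (Fin n) ℂ} (hM : M ∈ wordSpan A L) :
    ∃ p : NCPoly, deg p ≤ L ∧ eval₂ A p = M := by
  induction hM using Submodule.span_induction with
  | mem M hM =>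
    obtain ⟨w, hw, rfl⟩ := hM
    exact ⟨single (FreeMonoid.ofList w) 1,
      (deg_single_le _ _).trans (by simpa [FreeMonoid.length] using hw),
      by rw [eval₂_single, one_smul]; rfl⟩
  | zero => exact ⟨0, by simp [deg_zero], map_zero _⟩
  | add M N _ _ hM hN =>
    obtain ⟨p, hp, rfl⟩ := hM
    obtain ⟨q, hq, rfl⟩ := hN
    exact ⟨p + q, deg_add_le hp hq, map_add _ _ _⟩
  | smul c M _ hM =>
    obtain ⟨p, hp, rfl⟩ := hM
    exact ⟨c • p, deg_smul_le c hp, map_smul _ _ _⟩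

/-- `V_L` is exactly the set of values of polynomials of degree `≤ L`. [folklore] -/
theorem mem_wordSpan_iff {n : ℕ} {A : Fin 2 → Matrix (Fin n) (Fin n) ℂ} {L : ℕ}
    {M : Matrix (Fin n) (Fin n) ℂ} : M ∈ wordSpan A L ↔ ∃ p : NCPoly, deg p ≤ L ∧ eval₂ A p = M :=
  ⟨exists_poly_of_mem_wordSpan, fun ⟨_, hp, hM⟩ => hM ▸ eval₂_mem_wordSpan A hp⟩

/-- `V_i · V_j ⊆ V_{i+j}`. [folklore] -/
theorem mul_mem_wordSpan {n : ℕ} {A : Fin 2 → Matrix (Fin n) (Fin n) ℂ} {i j : ℕ}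
    {M N : Matrix (Fin n) (Fin n) ℂ} (hM : M ∈ wordSpan A i) (hN : N ∈ wordSpan A j) :
    M * N ∈ wordSpan A (i + j) := by
  obtain ⟨p, hp, rfl⟩ := exists_poly_of_mem_wordSpan hM
  obtain ⟨q, hq, rfl⟩ := exists_poly_of_mem_wordSpan hN
  rw [← map_mul]
  exact eval₂_mem_wordSpan A (deg_mul_le hp hq)

/-- `V_i^j ⊆ V_{j i}`. [folklore] -/
theorem pow_mem_wordSpan {n : ℕ} {A : Fin 2 → Matrix (Fin n) (Fin n) ℂ} {i : ℕ}
    {M : Matrix (Fin n) (Fin n) ℂ} (hM : M ∈ wordSpan A i) (j : ℕ) : M ^ j ∈ wordSpan A (j * i) := by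
  obtain ⟨p, hp, rfl⟩ := exists_poly_of_mem_wordSpan hM
  rw [← map_pow]
  exact eval₂_mem_wordSpan A (deg_pow_le hp j)

/-- If `V_L` contains `1` (it does) and is stable under left multiplication by both generators'
images inside a submodule `S ∋ 1`, then every `V_j ≤ S`; used as: a subspace containing `1` and
closed under left multiplication by `A 0, A 1` contains all words. [folklore] -/
theorem wordSpan_le_of_mul_mem {n : ℕ} (A : Fin 2 → Matrix (Fin n) (Fin n) ℂ)
    (S : Submodule ℂ (Matrix (Fin n) (Fin n) ℂ)) (h1 : (1 : Matrix (Fin n) (Fin n) ℂ) ∈ S)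
    (hmul : ∀ x : Fin 2, ∀ M ∈ S, A x * M ∈ S) (L : ℕ) : wordSpan A L ≤ S := by
  refine Submodule.span_le.2 ?_
  rintro M ⟨w, -, rfl⟩
  induction w with
  | nil => simpa using h1
  | cons x w ih =>
    rw [List.map_cons, List.prod_cons]
    exact hmul x _ ih

/-! ### Counting words -/

/-- The words of length `≤ L` are the image of a finite type of size `∑_{l ≤ L} 2^l`. [folklore] -/
theorem finrank_wordSpan_le {n : ℕ} (A : Fin 2 → Matrix (Fin n) (Fin n) ℂ) (L : ℕ) :
    Module.finrank ℂ (wordSpan A L) ≤ 2 ^ (L + 1) - 1 := by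
  classical
  let ι := Σ l : Fin (L + 1), (Fin l → Fin 2)
  let F : ι → Matrix (Fin n) (Fin n) ℂ := fun p => ((List.ofFn p.2).map A).prod
  have hsub : {M : Matrix (Fin n) (Fin n) ℂ | ∃ w : List (Fin 2), w.length ≤ L ∧ (w.map A).prod = M}
      ⊆ ((Finset.univ.image F : Finset (Matrix (Fin n) (Fin n) ℂ)) : Set (Matrix (Fin n) (Fin n) ℂ)) := by
    rintro M ⟨w, hw, rfl⟩
    simp only [Finset.coe_image, Finset.coe_univ, Set.image_univ, Set.mem_range]
    refine ⟨⟨⟨w.length, by omega⟩, w.get⟩, ?_⟩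
    simp only [F]
    rw [List.ofFn_get]
  have h1 : Module.finrank ℂ (wordSpan A L) ≤ (Finset.univ.image F).card := by
    have hle := finrank_span_finset_le_card (R := ℂ) (Finset.univ.image F)
    rw [Set.finrank] at hle
    exact (Submodule.finrank_mono (Submodule.span_mono hsub)).trans hle
  have h2 : (Finset.univ.image F).card ≤ Fintype.card ι := Finset.card_image_le.trans (by simp)
  have h3 : Fintype.card ι = ∑ l ∈ Finset.range (L + 1), 2 ^ l := by
    simp only [ι, Fintype.card_sigma, Fintype.card_fun, Fintype.card_fin]
    exact Fin.sum_univ_eq_sum_range (fun l => 2 ^ l) (L + 1)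
  have h4 : ∑ l ∈ Finset.range (L + 1), 2 ^ l = 2 ^ (L + 1) - 1 := by
    have := Nat.geomSum_eq (le_refl 2) (L + 1)
    simpa using this
  omega

/-- Generation in degree `d` forces `n² ≤ 2^(d+1) - 1`. [folklore] -/
theorem sq_le_of_wordSpan_eq_top {n d : ℕ} {A : Fin 2 → Matrix (Fin n) (Fin n) ℂ}
    (hspan : wordSpan A d = ⊤) : n ^ 2 ≤ 2 ^ (d + 1) - 1 := by
  have h := finrank_wordSpan_le A d
  rw [hspan, finrank_top, Module.finrank_matrix, Fintype.card_fin, Module.finrank_self,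
    mul_one] at h
  simpa [sq] using h

end Masquerade

end Summit.MatrixMultiplication.MatrixMultiplication.Theorems
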